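import Summits.CriticalPhenomena.PercolationContinuityZ3.Theorems.PercNearOneGluingNoHeavyLowerTailStarMonomialReduction
import HarnessLib

/-!
# `NoHeavyLowerTail` (stmt-CriticalPhenomena-4575) — star monomials of (Y13) read off the observer

Companion of `…LowerTailStarMonomialReduction` (route `PercNearOneGluingNoHeavy`, crux `NoHeavyLowerTail`, registered stub
`stub_sourceRepellerExchangeThreeRelays` = (Y13)).  There the (Y13) margin of an observer `o` attached to a finite set `A` was
written as one sixth of the sum of the symmetrised three-copy kernel of the SLICES `μ(E ∩ σ_B)` of its eight measures.  Here
each slice is read off `o` (Kozma–Nitzan, arXiv:2401.12397, Lemma 5: on `σ_B` two vertices `≠ o` are joined iff they are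
joined in `G ∖ o` with the vertices of `B` glued, `…ThreeHairKit.th_reach_iff_glue`; the star of `o` is independent of the
pairs off `o`, `…StarKit.th_real_inter_star`): `μ(E ∩ σ_B) = μ(σ_B) · μ_{G∖o}(E^B)` with `E^B` the event `E` of the punctured
graph in which `x ↔ y` is read "joined, or both joined to `B`" and `x ↔ o` is read "joined to `B`" (`sm_slice_*`).  Consequently
(`y13_of_gluedStarMonomials`) **(Y13) holds as soon as, for all `B₁, B₂, B₃ ⊆ A`, the symmetrised kernel of the three
independent copies of `G ∖ o` with the observer glued to `B_k` in copy `k` is nonnegative** — the "star monomial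
conjecture" form of the stub (RESIDUAL-gen11 §3; numerically 0 negatives in 3·10⁵ monomials); for `A ⊆ {a₁,a₂,a₃}` these
monomials are the nonnegative combinations of BHK rows of `…OneLayerExchange`.
-/

namespace Summit.CriticalPhenomena.PercolationContinuityZ3.Theorems

open MeasureTheory Set Literature.Probability.LatticeModels Literature.Probability.Percolation
open Literature.Probability.Percolation.KNPreFKG

noncomputable section

open Classical

section GluedKit

variable {V : Type*}

/-- Under `σ_B` (`B` a finite set of vertices `≠ o`), two vertices `≠ o` are joined iff they are joined off `o` or both are
joined off `o` to vertices of `B`. [cite: KozmaNitzan2024, Lemma 5 (p. 13)] -/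
theorem sm_kit_conn {ω : BondConfig V} {o : V} {B : Finset V} (hσ : ω ∈ starEvent o (↑B : Set V))
    (hB : ∀ u ∈ B, u ≠ o) {x y : V} (hx : x ≠ o) (hy : y ≠ o) :
    ω ∈ openConn x y ↔
      ω ∈ openConnIn {o}ᶜ x y ∨
        ((∃ u ∈ B, ω ∈ openConnIn {o}ᶜ x u) ∧ (∃ v ∈ B, ω ∈ openConnIn {o}ᶜ v y)) := by
  have h := th_reach_iff_glue (B := (↑B : Set V)) hσ (fun u hu => hB u (Finset.mem_coe.1 hu)) hx hy
  simp only [Finset.mem_coe] at h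
  exact h

/-- Under `σ_B`, a vertex `x ≠ o` is joined to `o` iff some vertex of `B` is joined to `x` off `o`.
[cite: KozmaNitzan2024, Lemma 5 (p. 13)] -/
theorem sm_kit_connO {ω : BondConfig V} {o : V} {B : Finset V} (hσ : ω ∈ starEvent o (↑B : Set V))
    (hB : ∀ u ∈ B, u ≠ o) {x : V} (hx : x ≠ o) :
    ω ∈ openConn x o ↔ ∃ u ∈ B, ω ∈ openConnIn {o}ᶜ u x := by
  change (openGraph ω).Reachable x o ↔ _
  constructor
  · intro h
    obtain ⟨u, huB, -, hux⟩ := (th_reach_o_iff hσ hx).1 h.symm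
    exact ⟨u, Finset.mem_coe.1 huB, hux⟩
  · rintro ⟨u, huB, hux⟩
    exact ((th_reach_o_iff hσ hx).2 ⟨u, Finset.mem_coe.2 huB, hB u huB, hux⟩).symm

/-- Pull-back of "`x` joined to a vertex of `B`" along the restriction to `{o}ᶜ`. [folklore] -/
theorem sm_kit_pre_exB {o : V} (ω : BondConfig V) (B : Finset V) (hB : ∀ u ∈ B, u ≠ o) (x : ({o}ᶜ : Set V)) :
    restrictConfig (Subtype.val : ({o}ᶜ : Set V) → V) ω ∈
        {ω' : BondConfig ({o}ᶜ : Set V) | ∃ u : ({o}ᶜ : Set V), (u : V) ∈ B ∧ ω' ∈ openConn x u} ↔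
      ∃ u ∈ B, ω ∈ openConnIn {o}ᶜ (x : V) u := by
  simp only [Set.mem_setOf_eq, th_kit_pre]
  constructor
  · rintro ⟨u, huB, h⟩
    exact ⟨u, huB, h⟩
  · rintro ⟨u, huB, h⟩
    exact ⟨⟨u, Set.mem_compl_singleton_iff.2 (hB u huB)⟩, huB, h⟩

/-- Pull-back of "a vertex of `B` joined to `x`" along the restriction to `{o}ᶜ`. [folklore] -/
theorem sm_kit_pre_Bex {o : V} (ω : BondConfig V) (B : Finset V) (hB : ∀ u ∈ B, u ≠ o) (x : ({o}ᶜ : Set V)) :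
    restrictConfig (Subtype.val : ({o}ᶜ : Set V) → V) ω ∈
        {ω' : BondConfig ({o}ᶜ : Set V) | ∃ u : ({o}ᶜ : Set V), (u : V) ∈ B ∧ ω' ∈ openConn u x} ↔
      ∃ u ∈ B, ω ∈ openConnIn {o}ᶜ u (x : V) := by
  simp only [Set.mem_setOf_eq, th_kit_pre]
  constructor
  · rintro ⟨u, huB, h⟩
    exact ⟨u, huB, h⟩
  · rintro ⟨u, huB, h⟩
    exact ⟨⟨u, Set.mem_compl_singleton_iff.2 (hB u huB)⟩, huB, h⟩

end GluedKit

section Slices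

variable {V : Type*} [Fintype V] (w : Sym2 V → unitInterval) (o : V) (a₁ a₂ a₃ b : ({o}ᶜ : Set V))
  (B : Finset V)

/-- **Slice of `N2` along `σ_B`, read off `o`** (`B` a finite set of vertices `≠ o`): `μ(N2 ∩ σ_B) = μ(σ_B)·μ_{G∖o}(N2^B)`.
[cite: KozmaNitzan2024, Lemma 5 and proof of Thm. 4 (pp. 13–14)] -/
theorem sm_slice_N2 (hB : ∀ u ∈ B, u ≠ o) :
    (prodBernoulli w).real (((openConn (a₂ : V) (a₁ : V))ᶜ ∩ (openConn (a₂ : V) (a₃ : V))ᶜ) ∩ starEvent o (↑B : Set V)) =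
      (prodBernoulli w).real (starEvent o (↑B : Set V)) *
        (prodBernoulli (w ∘ Sym2.map (Subtype.val : ({o}ᶜ : Set V) → V))).real
          (((openConn a₂ a₁ ∪ ({ω' : BondConfig ({o}ᶜ : Set V) | ∃ u : ({o}ᶜ : Set V), (u : V) ∈ B ∧ ω' ∈ openConn a₂ u} ∩ {ω' : BondConfig ({o}ᶜ : Set V) | ∃ v : ({o}ᶜ : Set V), (v : V) ∈ B ∧ ω' ∈ openConn v a₁})))ᶜ ∩ ((openConn a₂ a₃ ∪ ({ω' : BondConfig ({o}ᶜ : Set V) | ∃ u : ({o}ᶜ : Set V), (u : V) ∈ B ∧ ω' ∈ openConn a₂ u} ∩ {ω' : BondConfig ({o}ᶜ : Set V) | ∃ v : ({o}ᶜ : Set V), (v : V) ∈ B ∧ ω' ∈ openConn v a₃})))ᶜ) := by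
  have h1o : (a₁ : V) ≠ o := a₁.2
  have h2o : (a₂ : V) ≠ o := a₂.2
  have h3o : (a₃ : V) ≠ o := a₃.2
  exact th_real_inter_star w o (↑B : Set V) fun ω hσ => by
    simp only [Set.mem_inter_iff, Set.mem_compl_iff, Set.mem_union, sm_kit_conn hσ hB h2o h1o, sm_kit_conn hσ hB h2o h3o, th_kit_pre, sm_kit_pre_exB ω B hB, sm_kit_pre_Bex ω B hB]

/-- **Slice of `A2` along `σ_B`, read off `o`** (`B` a finite set of vertices `≠ o`): `μ(A2 ∩ σ_B) = μ(σ_B)·μ_{G∖o}(A2^B)`.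
[cite: KozmaNitzan2024, Lemma 5 and proof of Thm. 4 (pp. 13–14)] -/
theorem sm_slice_A2 (hB : ∀ u ∈ B, u ≠ o) :
    (prodBernoulli w).real (((openConn (a₂ : V) (a₁ : V))ᶜ ∩ (openConn (a₂ : V) (a₃ : V))ᶜ ∩ openConn (a₂ : V) o) ∩ starEvent o (↑B : Set V)) =
      (prodBernoulli w).real (starEvent o (↑B : Set V)) *
        (prodBernoulli (w ∘ Sym2.map (Subtype.val : ({o}ᶜ : Set V) → V))).real
          (((openConn a₂ a₁ ∪ ({ω' : BondConfig ({o}ᶜ : Set V) | ∃ u : ({o}ᶜ : Set V), (u : V) ∈ B ∧ ω' ∈ openConn a₂ u} ∩ {ω' : BondConfig ({o}ᶜ : Set V) | ∃ v : ({o}ᶜ : Set V), (v : V) ∈ B ∧ ω' ∈ openConn v a₁})))ᶜ ∩ ((openConn a₂ a₃ ∪ ({ω' : BondConfig ({o}ᶜ : Set V) | ∃ u : ({o}ᶜ : Set V), (u : V) ∈ B ∧ ω' ∈ openConn a₂ u} ∩ {ω' : BondConfig ({o}ᶜ : Set V) | ∃ v : ({o}ᶜ : Set V), (v : V) ∈ B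 ∧ ω' ∈ openConn v a₃})))ᶜ ∩ {ω' : BondConfig ({o}ᶜ : Set V) | ∃ u : ({o}ᶜ : Set V), (u : V) ∈ B ∧ ω' ∈ openConn u a₂}) := by
  have h1o : (a₁ : V) ≠ o := a₁.2
  have h2o : (a₂ : V) ≠ o := a₂.2
  have h3o : (a₃ : V) ≠ o := a₃.2
  exact th_real_inter_star w o (↑B : Set V) fun ω hσ => by
    simp only [Set.mem_inter_iff, Set.mem_compl_iff, Set.mem_union, sm_kit_conn hσ hB h2o h1o, sm_kit_conn hσ hB h2o h3o, sm_kit_connO hσ hB h2o, th_kit_pre, sm_kit_pre_exB ω B hB, sm_kit_pre_Bex ω B hB]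

/-- **Slice of `G1` along `σ_B`, read off `o`** (`B` a finite set of vertices `≠ o`): `μ(G1 ∩ σ_B) = μ(σ_B)·μ_{G∖o}(G1^B)`.
[cite: KozmaNitzan2024, Lemma 5 and proof of Thm. 4 (pp. 13–14)] -/
theorem sm_slice_G1 (hB : ∀ u ∈ B, u ≠ o) :
    (prodBernoulli w).real (((openConn (a₁ : V) (a₃ : V))ᶜ ∩ (openConn (a₁ : V) o ∩ openConn (a₁ : V) (b : V))) ∩ starEvent o (↑B : Set V)) =
      (prodBernoulli w).real (starEvent o (↑B : Set V)) *
        (prodBernoulli (w ∘ Sym2.map (Subtype.val : ({o}ᶜ : Set V) → V))).real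
          (((openConn a₁ a₃ ∪ ({ω' : BondConfig ({o}ᶜ : Set V) | ∃ u : ({o}ᶜ : Set V), (u : V) ∈ B ∧ ω' ∈ openConn a₁ u} ∩ {ω' : BondConfig ({o}ᶜ : Set V) | ∃ v : ({o}ᶜ : Set V), (v : V) ∈ B ∧ ω' ∈ openConn v a₃})))ᶜ ∩ ({ω' : BondConfig ({o}ᶜ : Set V) | ∃ u : ({o}ᶜ : Set V), (u : V) ∈ B ∧ ω' ∈ openConn u a₁} ∩ (openConn a₁ b ∪ ({ω' : BondConfig ({o}ᶜ : Set V) | ∃ u : ({o}ᶜ : Set V), (u : V) ∈ B ∧ ω' ∈ openConn a₁ u} ∩ {ω' : BondConfig ({o}ᶜ : Set V) | ∃ v : ({o}ᶜ : Set V), (v : V) ∈ B ∧ ω' ∈ openConn v b})))) := by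
  have h1o : (a₁ : V) ≠ o := a₁.2
  have h3o : (a₃ : V) ≠ o := a₃.2
  have hbo : (b : V) ≠ o := b.2
  exact th_real_inter_star w o (↑B : Set V) fun ω hσ => by
    simp only [Set.mem_inter_iff, Set.mem_compl_iff, Set.mem_union, sm_kit_conn hσ hB h1o h3o, sm_kit_conn hσ hB h1o hbo, sm_kit_connO hσ hB h1o, th_kit_pre, sm_kit_pre_exB ω B hB, sm_kit_pre_Bex ω B hB]

/-- **Slice of `G3` along `σ_B`, read off `o`** (`B` a finite set of vertices `≠ o`): `μ(G3 ∩ σ_B) = μ(σ_B)·μ_{G∖o}(G3^B)`.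
[cite: KozmaNitzan2024, Lemma 5 and proof of Thm. 4 (pp. 13–14)] -/
theorem sm_slice_G3 (hB : ∀ u ∈ B, u ≠ o) :
    (prodBernoulli w).real (((openConn (a₁ : V) (a₃ : V))ᶜ ∩ (openConn (a₁ : V) o ∩ openConn (a₃ : V) (b : V))) ∩ starEvent o (↑B : Set V)) =
      (prodBernoulli w).real (starEvent o (↑B : Set V)) *
        (prodBernoulli (w ∘ Sym2.map (Subtype.val : ({o}ᶜ : Set V) → V))).real
          (((openConn a₁ a₃ ∪ ({ω' : BondConfig ({o}ᶜ : Set V) | ∃ u : ({o}ᶜ : Set V), (u : V) ∈ B ∧ ω' ∈ openConn a₁ u} ∩ {ω' : BondConfig ({o}ᶜ : Set V) | ∃ v : ({o}ᶜ : Set V), (v : V) ∈ B ∧ ω' ∈ openConn v a₃})))ᶜ ∩ ({ω' : BondConfig ({o}ᶜ : Set V) | ∃ u : ({o}ᶜ : Set V), (u : V) ∈ B ∧ ω' ∈ openConn u a₁} ∩ (openConn a₃ b ∪ ({ω' : BondConfig ({o}ᶜ : Set V) | ∃ u : ({o}ᶜ : Set V), (u : V) ∈ B ∧ ω' ∈ openConn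 a₃ u} ∩ {ω' : BondConfig ({o}ᶜ : Set V) | ∃ v : ({o}ᶜ : Set V), (v : V) ∈ B ∧ ω' ∈ openConn v b})))) := by
  have h1o : (a₁ : V) ≠ o := a₁.2
  have h3o : (a₃ : V) ≠ o := a₃.2
  have hbo : (b : V) ≠ o := b.2
  exact th_real_inter_star w o (↑B : Set V) fun ω hσ => by
    simp only [Set.mem_inter_iff, Set.mem_compl_iff, Set.mem_union, sm_kit_conn hσ hB h1o h3o, sm_kit_conn hσ hB h3o hbo, sm_kit_connO hσ hB h1o, th_kit_pre, sm_kit_pre_exB ω B hB, sm_kit_pre_Bex ω B hB]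

/-- **Slice of `J1` along `σ_B`, read off `o`** (`B` a finite set of vertices `≠ o`): `μ(J1 ∩ σ_B) = μ(σ_B)·μ_{G∖o}(J1^B)`.
[cite: KozmaNitzan2024, Lemma 5 and proof of Thm. 4 (pp. 13–14)] -/
theorem sm_slice_J1 (hB : ∀ u ∈ B, u ≠ o) :
    (prodBernoulli w).real (((openConn (a₁ : V) (a₃ : V))ᶜ ∩ (openConn (a₁ : V) (a₂ : V) ∩ openConn (a₁ : V) (b : V))) ∩ starEvent o (↑B : Set V)) =
      (prodBernoulli w).real (starEvent o (↑B : Set V)) *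
        (prodBernoulli (w ∘ Sym2.map (Subtype.val : ({o}ᶜ : Set V) → V))).real
          (((openConn a₁ a₃ ∪ ({ω' : BondConfig ({o}ᶜ : Set V) | ∃ u : ({o}ᶜ : Set V), (u : V) ∈ B ∧ ω' ∈ openConn a₁ u} ∩ {ω' : BondConfig ({o}ᶜ : Set V) | ∃ v : ({o}ᶜ : Set V), (v : V) ∈ B ∧ ω' ∈ openConn v a₃})))ᶜ ∩ ((openConn a₁ a₂ ∪ ({ω' : BondConfig ({o}ᶜ : Set V) | ∃ u : ({o}ᶜ : Set V), (u : V) ∈ B ∧ ω' ∈ openConn a₁ u} ∩ {ω' : BondConfig ({o}ᶜ : Set V) | ∃ v : ({o}ᶜ : Set V), (v : V) ∈ B ∧ ω' ∈ openConn v a₂})) ∩ (openConn a₁ b ∪ ({ω' : BondConfig ({o}ᶜ : Set V) | ∃ u : ({o}ᶜ : Set V), (u : V) ∈ B ∧ ω' ∈ openConn a₁ u} ∩ {ω' : BondConfig ({o}ᶜ : Set V) | ∃ v : ({o}ᶜ : Set V), (v : V) ∈ B ∧ ω' ∈ openConn v b})))) := by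
  have h1o : (a₁ : V) ≠ o := a₁.2
  have h2o : (a₂ : V) ≠ o := a₂.2
  have h3o : (a₃ : V) ≠ o := a₃.2
  have hbo : (b : V) ≠ o := b.2
  exact th_real_inter_star w o (↑B : Set V) fun ω hσ => by
    simp only [Set.mem_inter_iff, Set.mem_compl_iff, Set.mem_union, sm_kit_conn hσ hB h1o h3o, sm_kit_conn hσ hB h1o h2o, sm_kit_conn hσ hB h1o hbo, th_kit_pre, sm_kit_pre_exB ω B hB, sm_kit_pre_Bex ω B hB]

/-- **Slice of `J3` along `σ_B`, read off `o`** (`B` a finite set of vertices `≠ o`): `μ(J3 ∩ σ_B) = μ(σ_B)·μ_{G∖o}(J3^B)`.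
[cite: KozmaNitzan2024, Lemma 5 and proof of Thm. 4 (pp. 13–14)] -/
theorem sm_slice_J3 (hB : ∀ u ∈ B, u ≠ o) :
    (prodBernoulli w).real (((openConn (a₁ : V) (a₃ : V))ᶜ ∩ (openConn (a₁ : V) (a₂ : V) ∩ openConn (a₃ : V) (b : V))) ∩ starEvent o (↑B : Set V)) =
      (prodBernoulli w).real (starEvent o (↑B : Set V)) *
        (prodBernoulli (w ∘ Sym2.map (Subtype.val : ({o}ᶜ : Set V) → V))).real
          (((openConn a₁ a₃ ∪ ({ω' : BondConfig ({o}ᶜ : Set V) | ∃ u : ({o}ᶜ : Set V), (u : V) ∈ B ∧ ω' ∈ openConn a₁ u} ∩ {ω' : BondConfig ({o}ᶜ : Set V) | ∃ v : ({o}ᶜ : Set V), (v : V) ∈ B ∧ ω' ∈ openConn v a₃})))ᶜ ∩ ((openConn a₁ a₂ ∪ ({ω' : BondConfig ({o}ᶜ : Set V) | ∃ u : ({o}ᶜ : Set V), (u : V) ∈ B ∧ ω' ∈ openConn a₁ u} ∩ {ω' : BondConfig ({o}ᶜ : Set V) | ∃ v : ({o}ᶜ : Set V), (v : V) ∈ B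 ∧ ω' ∈ openConn v a₂})) ∩ (openConn a₃ b ∪ ({ω' : BondConfig ({o}ᶜ : Set V) | ∃ u : ({o}ᶜ : Set V), (u : V) ∈ B ∧ ω' ∈ openConn a₃ u} ∩ {ω' : BondConfig ({o}ᶜ : Set V) | ∃ v : ({o}ᶜ : Set V), (v : V) ∈ B ∧ ω' ∈ openConn v b})))) := by
  have h1o : (a₁ : V) ≠ o := a₁.2
  have h2o : (a₂ : V) ≠ o := a₂.2
  have h3o : (a₃ : V) ≠ o := a₃.2
  have hbo : (b : V) ≠ o := b.2
  exact th_real_inter_star w o (↑B : Set V) fun ω hσ => by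
    simp only [Set.mem_inter_iff, Set.mem_compl_iff, Set.mem_union, sm_kit_conn hσ hB h1o h3o, sm_kit_conn hσ hB h1o h2o, sm_kit_conn hσ hB h3o hbo, th_kit_pre, sm_kit_pre_exB ω B hB, sm_kit_pre_Bex ω B hB]

/-- **Slice of `g1` along `σ_B`, read off `o`** (`B` a finite set of vertices `≠ o`): `μ(g1 ∩ σ_B) = μ(σ_B)·μ_{G∖o}(g1^B)`.
[cite: KozmaNitzan2024, Lemma 5 and proof of Thm. 4 (pp. 13–14)] -/
theorem sm_slice_g1 (hB : ∀ u ∈ B, u ≠ o) :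
    (prodBernoulli w).real (((openConn (a₁ : V) (a₃ : V))ᶜ ∩ openConn (a₁ : V) (b : V)) ∩ starEvent o (↑B : Set V)) =
      (prodBernoulli w).real (starEvent o (↑B : Set V)) *
        (prodBernoulli (w ∘ Sym2.map (Subtype.val : ({o}ᶜ : Set V) → V))).real
          (((openConn a₁ a₃ ∪ ({ω' : BondConfig ({o}ᶜ : Set V) | ∃ u : ({o}ᶜ : Set V), (u : V) ∈ B ∧ ω' ∈ openConn a₁ u} ∩ {ω' : BondConfig ({o}ᶜ : Set V) | ∃ v : ({o}ᶜ : Set V), (v : V) ∈ B ∧ ω' ∈ openConn v a₃})))ᶜ ∩ (openConn a₁ b ∪ ({ω' : BondConfig ({o}ᶜ : Set V) | ∃ u : ({o}ᶜ : Set V), (u : V) ∈ B ∧ ω' ∈ openConn a₁ u} ∩ {ω' : BondConfig ({o}ᶜ : Set V) | ∃ v : ({o}ᶜ : Set V), (v : V) ∈ B ∧ ω' ∈ openConn v b}))) := by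
  have h1o : (a₁ : V) ≠ o := a₁.2
  have h3o : (a₃ : V) ≠ o := a₃.2
  have hbo : (b : V) ≠ o := b.2
  exact th_real_inter_star w o (↑B : Set V) fun ω hσ => by
    simp only [Set.mem_inter_iff, Set.mem_compl_iff, Set.mem_union, sm_kit_conn hσ hB h1o h3o, sm_kit_conn hσ hB h1o hbo, th_kit_pre, sm_kit_pre_exB ω B hB, sm_kit_pre_Bex ω B hB]

/-- **Slice of `g3` along `σ_B`, read off `o`** (`B` a finite set of vertices `≠ o`): `μ(g3 ∩ σ_B) = μ(σ_B)·μ_{G∖o}(g3^B)`.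
[cite: KozmaNitzan2024, Lemma 5 and proof of Thm. 4 (pp. 13–14)] -/
theorem sm_slice_g3 (hB : ∀ u ∈ B, u ≠ o) :
    (prodBernoulli w).real (((openConn (a₁ : V) (a₃ : V))ᶜ ∩ openConn (a₃ : V) (b : V)) ∩ starEvent o (↑B : Set V)) =
      (prodBernoulli w).real (starEvent o (↑B : Set V)) *
        (prodBernoulli (w ∘ Sym2.map (Subtype.val : ({o}ᶜ : Set V) → V))).real
          (((openConn a₁ a₃ ∪ ({ω' : BondConfig ({o}ᶜ : Set V) | ∃ u : ({o}ᶜ : Set V), (u : V) ∈ B ∧ ω' ∈ openConn a₁ u} ∩ {ω' : BondConfig ({o}ᶜ : Set V) | ∃ v : ({o}ᶜ : Set V), (v : V) ∈ B ∧ ω' ∈ openConn v a₃})))ᶜ ∩ (openConn a₃ b ∪ ({ω' : BondConfig ({o}ᶜ : Set V) | ∃ u : ({o}ᶜ : Set V), (u : V) ∈ B ∧ ω' ∈ openConn a₃ u} ∩ {ω' : BondConfig ({o}ᶜ : Set V) | ∃ v : ({o}ᶜ : Set V), (v : V) ∈ B ∧ ω' ∈ openConn v b}))) := by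
  have h1o : (a₁ : V) ≠ o := a₁.2
  have h3o : (a₃ : V) ≠ o := a₃.2
  have hbo : (b : V) ≠ o := b.2
  exact th_real_inter_star w o (↑B : Set V) fun ω hσ => by
    simp only [Set.mem_inter_iff, Set.mem_compl_iff, Set.mem_union, sm_kit_conn hσ hB h1o h3o, sm_kit_conn hσ hB h3o hbo, th_kit_pre, sm_kit_pre_exB ω B hB, sm_kit_pre_Bex ω B hB]

end Slices

section GluedMonomials

variable {V : Type*} [Fintype V]

/-- **The slice kernel factorises**: for `B₁, B₂, B₃` finite sets of vertices `≠ o`, the three-copy kernel of the slices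
along `σ_{B₁}, σ_{B₂}, σ_{B₃}` equals `μ(σ_{B₁})μ(σ_{B₂})μ(σ_{B₃})` times the glued kernel `Ψ(B₁,B₂,B₃)` of `G ∖ o`.
[cite: KozmaNitzan2024, Lemma 5 and proof of Thm. 4 (pp. 13–14)] -/
theorem sm_kernel_factor (w : Sym2 V → unitInterval) (o : V) (a₁ a₂ a₃ b : ({o}ᶜ : Set V))
    (Ψ : Finset V → Finset V → Finset V → ℝ)
    (hΨ : ∀ B₁ B₂ B₃,
      Ψ B₁ B₂ B₃ =
        (prodBernoulli (w ∘ Sym2.map (Subtype.val : ({o}ᶜ : Set V) → V))).real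
              (((openConn a₂ a₁ ∪ ({ω' : BondConfig ({o}ᶜ : Set V) | ∃ u : ({o}ᶜ : Set V), (u : V) ∈ B₁ ∧ ω' ∈ openConn a₂ u} ∩ {ω' : BondConfig ({o}ᶜ : Set V) | ∃ v : ({o}ᶜ : Set V), (v : V) ∈ B₁ ∧ ω' ∈ openConn v a₁})))ᶜ ∩ ((openConn a₂ a₃ ∪ ({ω' : BondConfig ({o}ᶜ : Set V) | ∃ u : ({o}ᶜ : Set V), (u : V) ∈ B₁ ∧ ω' ∈ openConn a₂ u} ∩ {ω' : BondConfig ({o}ᶜ : Set V) | ∃ v : ({o}ᶜ : Set V), (v : V) ∈ B₁ ∧ ω' ∈ openConn v a₃})))ᶜ) *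
            ((prodBernoulli (w ∘ Sym2.map (Subtype.val : ({o}ᶜ : Set V) → V))).real
              (((openConn a₁ a₃ ∪ ({ω' : BondConfig ({o}ᶜ : Set V) | ∃ u : ({o}ᶜ : Set V), (u : V) ∈ B₂ ∧ ω' ∈ openConn a₁ u} ∩ {ω' : BondConfig ({o}ᶜ : Set V) | ∃ v : ({o}ᶜ : Set V), (v : V) ∈ B₂ ∧ ω' ∈ openConn v a₃})))ᶜ ∩ ({ω' : BondConfig ({o}ᶜ : Set V) | ∃ u : ({o}ᶜ : Set V), (u : V) ∈ B₂ ∧ ω' ∈ openConn u a₁} ∩ (openConn a₁ b ∪ ({ω' : BondConfig ({o}ᶜ : Set V) | ∃ u : ({o}ᶜ : Set V), (u : V) ∈ B₂ ∧ ω' ∈ openConn a₁ u} ∩ {ω' : BondConfig ({o}ᶜ : Set V) | ∃ v : ({o}ᶜ : Set V), (v : V) ∈ B₂ ∧ ω' ∈ openConn v b})))) *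
                (prodBernoulli (w ∘ Sym2.map (Subtype.val : ({o}ᶜ : Set V) → V))).real
              (((openConn a₁ a₃ ∪ ({ω' : BondConfig ({o}ᶜ : Set V) | ∃ u : ({o}ᶜ : Set V), (u : V) ∈ B₃ ∧ ω' ∈ openConn a₁ u} ∩ {ω' : BondConfig ({o}ᶜ : Set V) | ∃ v : ({o}ᶜ : Set V), (v : V) ∈ B₃ ∧ ω' ∈ openConn v a₃})))ᶜ ∩ (openConn a₃ b ∪ ({ω' : BondConfig ({o}ᶜ : Set V) | ∃ u : ({o}ᶜ : Set V), (u : V) ∈ B₃ ∧ ω' ∈ openConn a₃ u} ∩ {ω' : BondConfig ({o}ᶜ : Set V) | ∃ v : ({o}ᶜ : Set V), (v : V) ∈ B₃ ∧ ω' ∈ openConn v b}))) -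
              (prodBernoulli (w ∘ Sym2.map (Subtype.val : ({o}ᶜ : Set V) → V))).real
              (((openConn a₁ a₃ ∪ ({ω' : BondConfig ({o}ᶜ : Set V) | ∃ u : ({o}ᶜ : Set V), (u : V) ∈ B₂ ∧ ω' ∈ openConn a₁ u} ∩ {ω' : BondConfig ({o}ᶜ : Set V) | ∃ v : ({o}ᶜ : Set V), (v : V) ∈ B₂ ∧ ω' ∈ openConn v a₃})))ᶜ ∩ ({ω' : BondConfig ({o}ᶜ : Set V) | ∃ u : ({o}ᶜ : Set V), (u : V) ∈ B₂ ∧ ω' ∈ openConn u a₁} ∩ (openConn a₃ b ∪ ({ω' : BondConfig ({o}ᶜ : Set V) | ∃ u : ({o}ᶜ : Set V), (u : V) ∈ B₂ ∧ ω' ∈ openConn a₃ u} ∩ {ω' : BondConfig ({o}ᶜ : Set V) | ∃ v : ({o}ᶜ : Set V), (v : V) ∈ B₂ ∧ ω' ∈ openConn v b})))) *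
                (prodBernoulli (w ∘ Sym2.map (Subtype.val : ({o}ᶜ : Set V) → V))).real
              (((openConn a₁ a₃ ∪ ({ω' : BondConfig ({o}ᶜ : Set V) | ∃ u : ({o}ᶜ : Set V), (u : V) ∈ B₃ ∧ ω' ∈ openConn a₁ u} ∩ {ω' : BondConfig ({o}ᶜ : Set V) | ∃ v : ({o}ᶜ : Set V), (v : V) ∈ B₃ ∧ ω' ∈ openConn v a₃})))ᶜ ∩ (openConn a₁ b ∪ ({ω' : BondConfig ({o}ᶜ : Set V) | ∃ u : ({o}ᶜ : Set V), (u : V) ∈ B₃ ∧ ω' ∈ openConn a₁ u} ∩ {ω' : BondConfig ({o}ᶜ : Set V) | ∃ v : ({o}ᶜ : Set V), (v : V) ∈ B₃ ∧ ω' ∈ openConn v b})))) -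
          (prodBernoulli (w ∘ Sym2.map (Subtype.val : ({o}ᶜ : Set V) → V))).real
              (((openConn a₂ a₁ ∪ ({ω' : BondConfig ({o}ᶜ : Set V) | ∃ u : ({o}ᶜ : Set V), (u : V) ∈ B₁ ∧ ω' ∈ openConn a₂ u} ∩ {ω' : BondConfig ({o}ᶜ : Set V) | ∃ v : ({o}ᶜ : Set V), (v : V) ∈ B₁ ∧ ω' ∈ openConn v a₁})))ᶜ ∩ ((openConn a₂ a₃ ∪ ({ω' : BondConfig ({o}ᶜ : Set V) | ∃ u : ({o}ᶜ : Set V), (u : V) ∈ B₁ ∧ ω' ∈ openConn a₂ u} ∩ {ω' : BondConfig ({o}ᶜ : Set V) | ∃ v : ({o}ᶜ : Set V), (v : V) ∈ B₁ ∧ ω' ∈ openConn v a₃})))ᶜ ∩ {ω' : BondConfig ({o}ᶜ : Set V) | ∃ u : ({o}ᶜ : Set V), (u : V) ∈ B₁ ∧ ω' ∈ openConn u a₂}) *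
            ((prodBernoulli (w ∘ Sym2.map (Subtype.val : ({o}ᶜ : Set V) → V))).real
              (((openConn a₁ a₃ ∪ ({ω' : BondConfig ({o}ᶜ : Set V) | ∃ u : ({o}ᶜ : Set V), (u : V) ∈ B₂ ∧ ω' ∈ openConn a₁ u} ∩ {ω' : BondConfig ({o}ᶜ : Set V) | ∃ v : ({o}ᶜ : Set V), (v : V) ∈ B₂ ∧ ω' ∈ openConn v a₃})))ᶜ ∩ ((openConn a₁ a₂ ∪ ({ω' : BondConfig ({o}ᶜ : Set V) | ∃ u : ({o}ᶜ : Set V), (u : V) ∈ B₂ ∧ ω' ∈ openConn a₁ u} ∩ {ω' : BondConfig ({o}ᶜ : Set V) | ∃ v : ({o}ᶜ : Set V), (v : V) ∈ B₂ ∧ ω' ∈ openConn v a₂})) ∩ (openConn a₁ b ∪ ({ω' : BondConfig ({o}ᶜ : Set V) | ∃ u : ({o}ᶜ : Set V), (u : V) ∈ B₂ ∧ ω' ∈ openConn a₁ u} ∩ {ω' : BondConfig ({o}ᶜ : Set V) | ∃ v : ({o}ᶜ : Set V), (v : V) ∈ B₂ ∧ ω' ∈ openConn v b})))) *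
                (prodBernoulli (w ∘ Sym2.map (Subtype.val : ({o}ᶜ : Set V) → V))).real
              (((openConn a₁ a₃ ∪ ({ω' : BondConfig ({o}ᶜ : Set V) | ∃ u : ({o}ᶜ : Set V), (u : V) ∈ B₃ ∧ ω' ∈ openConn a₁ u} ∩ {ω' : BondConfig ({o}ᶜ : Set V) | ∃ v : ({o}ᶜ : Set V), (v : V) ∈ B₃ ∧ ω' ∈ openConn v a₃})))ᶜ ∩ (openConn a₃ b ∪ ({ω' : BondConfig ({o}ᶜ : Set V) | ∃ u : ({o}ᶜ : Set V), (u : V) ∈ B₃ ∧ ω' ∈ openConn a₃ u} ∩ {ω' : BondConfig ({o}ᶜ : Set V) | ∃ v : ({o}ᶜ : Set V), (v : V) ∈ B₃ ∧ ω' ∈ openConn v b}))) -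
              (prodBernoulli (w ∘ Sym2.map (Subtype.val : ({o}ᶜ : Set V) → V))).real
              (((openConn a₁ a₃ ∪ ({ω' : BondConfig ({o}ᶜ : Set V) | ∃ u : ({o}ᶜ : Set V), (u : V) ∈ B₂ ∧ ω' ∈ openConn a₁ u} ∩ {ω' : BondConfig ({o}ᶜ : Set V) | ∃ v : ({o}ᶜ : Set V), (v : V) ∈ B₂ ∧ ω' ∈ openConn v a₃})))ᶜ ∩ ((openConn a₁ a₂ ∪ ({ω' : BondConfig ({o}ᶜ : Set V) | ∃ u : ({o}ᶜ : Set V), (u : V) ∈ B₂ ∧ ω' ∈ openConn a₁ u} ∩ {ω' : BondConfig ({o}ᶜ : Set V) | ∃ v : ({o}ᶜ : Set V), (v : V) ∈ B₂ ∧ ω' ∈ openConn v a₂})) ∩ (openConn a₃ b ∪ ({ω' : BondConfig ({o}ᶜ : Set V) | ∃ u : ({o}ᶜ : Set V), (u : V) ∈ B₂ ∧ ω' ∈ openConn a₃ u} ∩ {ω' : BondConfig ({o}ᶜ : Set V) | ∃ v : ({o}ᶜ : Set V), (v : V) ∈ B₂ ∧ ω' ∈ openConn v b})))) *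
                (prodBernoulli (w ∘ Sym2.map (Subtype.val : ({o}ᶜ : Set V) → V))).real
              (((openConn a₁ a₃ ∪ ({ω' : BondConfig ({o}ᶜ : Set V) | ∃ u : ({o}ᶜ : Set V), (u : V) ∈ B₃ ∧ ω' ∈ openConn a₁ u} ∩ {ω' : BondConfig ({o}ᶜ : Set V) | ∃ v : ({o}ᶜ : Set V), (v : V) ∈ B₃ ∧ ω' ∈ openConn v a₃})))ᶜ ∩ (openConn a₁ b ∪ ({ω' : BondConfig ({o}ᶜ : Set V) | ∃ u : ({o}ᶜ : Set V), (u : V) ∈ B₃ ∧ ω' ∈ openConn a₁ u} ∩ {ω' : BondConfig ({o}ᶜ : Set V) | ∃ v : ({o}ᶜ : Set V), (v : V) ∈ B₃ ∧ ω' ∈ openConn v b})))))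
    (B₁ B₂ B₃ : Finset V) (hB₁ : ∀ u ∈ B₁, u ≠ o) (hB₂ : ∀ u ∈ B₂, u ≠ o) (hB₃ : ∀ u ∈ B₃, u ≠ o) :
    (prodBernoulli w).real (((openConn (a₂ : V) (a₁ : V))ᶜ ∩ (openConn (a₂ : V) (a₃ : V))ᶜ) ∩ starEvent o ↑B₁) *
            ((prodBernoulli w).real (((openConn (a₁ : V) (a₃ : V))ᶜ ∩ (openConn (a₁ : V) o ∩ openConn (a₁ : V) (b : V))) ∩ starEvent o ↑B₂) *
                (prodBernoulli w).real (((openConn (a₁ : V) (a₃ : V))ᶜ ∩ openConn (a₃ : V) (b : V)) ∩ starEvent o ↑B₃) -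
              (prodBernoulli w).real (((openConn (a₁ : V) (a₃ : V))ᶜ ∩ (openConn (a₁ : V) o ∩ openConn (a₃ : V) (b : V))) ∩ starEvent o ↑B₂) *
                (prodBernoulli w).real (((openConn (a₁ : V) (a₃ : V))ᶜ ∩ openConn (a₁ : V) (b : V)) ∩ starEvent o ↑B₃)) -
          (prodBernoulli w).real (((openConn (a₂ : V) (a₁ : V))ᶜ ∩ (openConn (a₂ : V) (a₃ : V))ᶜ ∩ openConn (a₂ : V) o) ∩ starEvent o ↑B₁) *
            ((prodBernoulli w).real (((openConn (a₁ : V) (a₃ : V))ᶜ ∩ (openConn (a₁ : V) (a₂ : V) ∩ openConn (a₁ : V) (b : V))) ∩ starEvent o ↑B₂) *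
                (prodBernoulli w).real (((openConn (a₁ : V) (a₃ : V))ᶜ ∩ openConn (a₃ : V) (b : V)) ∩ starEvent o ↑B₃) -
              (prodBernoulli w).real (((openConn (a₁ : V) (a₃ : V))ᶜ ∩ (openConn (a₁ : V) (a₂ : V) ∩ openConn (a₃ : V) (b : V))) ∩ starEvent o ↑B₂) *
                (prodBernoulli w).real (((openConn (a₁ : V) (a₃ : V))ᶜ ∩ openConn (a₁ : V) (b : V)) ∩ starEvent o ↑B₃)) =
      (prodBernoulli w).real (starEvent o (↑B₁ : Set V)) * (prodBernoulli w).real (starEvent o (↑B₂ : Set V)) * (prodBernoulli w).real (starEvent o (↑B₃ : Set V)) *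
        Ψ B₁ B₂ B₃ := by
  rw [hΨ, sm_slice_N2 w o a₁ a₂ a₃ B₁ hB₁, sm_slice_A2 w o a₁ a₂ a₃ B₁ hB₁,
    sm_slice_G1 w o a₁ a₃ b B₂ hB₂, sm_slice_G3 w o a₁ a₃ b B₂ hB₂,
    sm_slice_J1 w o a₁ a₂ a₃ b B₂ hB₂, sm_slice_J3 w o a₁ a₂ a₃ b B₂ hB₂,
    sm_slice_g1 w o a₁ a₃ b B₃ hB₃, sm_slice_g3 w o a₁ a₃ b B₃ hB₃]
  ring

/-- **(Y13) from nonnegative glued star monomials.**  Let the observer `o` carry positive weight only on pairs into the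
finite set `A ∌ o`, and for `B ⊆ A` read the events of (Y13) in `G ∖ o` with `o` glued to `B` (`x ↔ y` becomes "joined,
or both joined to `B`"; `x ↔ o` becomes "joined to `B`").  If for all `B₁, B₂, B₃ ⊆ A` the symmetrised three-copy kernel
`Σ_{π∈S₃} Ψ(B_π)`, `Ψ(B₁,B₂,B₃) = μ'(N₂^{B₁})(μ'(G₁^{B₂})μ'(g₃^{B₃}) − μ'(G₃^{B₂})μ'(g₁^{B₃})) −
μ'(A₂^{B₁})(μ'(J₁^{B₂})μ'(g₃^{B₃}) − μ'(J₃^{B₂})μ'(g₁^{B₃}))` (three INDEPENDENT copies of `G ∖ o`), is nonnegative,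
then the source/repeller exchange row `stub_sourceRepellerExchangeThreeRelays` holds for `(w, o, b, a₁, a₂, a₃)`.
[cite: KozmaNitzan2024, Lemma 5 and proof of Thm. 4 (pp. 13–14)] -/
theorem y13_of_gluedStarMonomials (w : Sym2 V → unitInterval) (o : V) (a₁ a₂ a₃ b : ({o}ᶜ : Set V)) (A : Finset V)
    (ho : o ∉ A) (hiso : ∀ u, u ≠ o → u ∉ A → w s(o, u) = 0) (Ψ : Finset V → Finset V → Finset V → ℝ)
    (hΨ : ∀ B₁ B₂ B₃,
      Ψ B₁ B₂ B₃ =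
        (prodBernoulli (w ∘ Sym2.map (Subtype.val : ({o}ᶜ : Set V) → V))).real
              (((openConn a₂ a₁ ∪ ({ω' : BondConfig ({o}ᶜ : Set V) | ∃ u : ({o}ᶜ : Set V), (u : V) ∈ B₁ ∧ ω' ∈ openConn a₂ u} ∩ {ω' : BondConfig ({o}ᶜ : Set V) | ∃ v : ({o}ᶜ : Set V), (v : V) ∈ B₁ ∧ ω' ∈ openConn v a₁})))ᶜ ∩ ((openConn a₂ a₃ ∪ ({ω' : BondConfig ({o}ᶜ : Set V) | ∃ u : ({o}ᶜ : Set V), (u : V) ∈ B₁ ∧ ω' ∈ openConn a₂ u} ∩ {ω' : BondConfig ({o}ᶜ : Set V) | ∃ v : ({o}ᶜ : Set V), (v : V) ∈ B₁ ∧ ω' ∈ openConn v a₃})))ᶜ) *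
            ((prodBernoulli (w ∘ Sym2.map (Subtype.val : ({o}ᶜ : Set V) → V))).real
              (((openConn a₁ a₃ ∪ ({ω' : BondConfig ({o}ᶜ : Set V) | ∃ u : ({o}ᶜ : Set V), (u : V) ∈ B₂ ∧ ω' ∈ openConn a₁ u} ∩ {ω' : BondConfig ({o}ᶜ : Set V) | ∃ v : ({o}ᶜ : Set V), (v : V) ∈ B₂ ∧ ω' ∈ openConn v a₃})))ᶜ ∩ ({ω' : BondConfig ({o}ᶜ : Set V) | ∃ u : ({o}ᶜ : Set V), (u : V) ∈ B₂ ∧ ω' ∈ openConn u a₁} ∩ (openConn a₁ b ∪ ({ω' : BondConfig ({o}ᶜ : Set V) | ∃ u : ({o}ᶜ : Set V), (u : V) ∈ B₂ ∧ ω' ∈ openConn a₁ u} ∩ {ω' : BondConfig ({o}ᶜ : Set V) | ∃ v : ({o}ᶜ : Set V), (v : V) ∈ B₂ ∧ ω' ∈ openConn v b})))) *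
                (prodBernoulli (w ∘ Sym2.map (Subtype.val : ({o}ᶜ : Set V) → V))).real
              (((openConn a₁ a₃ ∪ ({ω' : BondConfig ({o}ᶜ : Set V) | ∃ u : ({o}ᶜ : Set V), (u : V) ∈ B₃ ∧ ω' ∈ openConn a₁ u} ∩ {ω' : BondConfig ({o}ᶜ : Set V) | ∃ v : ({o}ᶜ : Set V), (v : V) ∈ B₃ ∧ ω' ∈ openConn v a₃})))ᶜ ∩ (openConn a₃ b ∪ ({ω' : BondConfig ({o}ᶜ : Set V) | ∃ u : ({o}ᶜ : Set V), (u : V) ∈ B₃ ∧ ω' ∈ openConn a₃ u} ∩ {ω' : BondConfig ({o}ᶜ : Set V) | ∃ v : ({o}ᶜ : Set V), (v : V) ∈ B₃ ∧ ω' ∈ openConn v b}))) -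
              (prodBernoulli (w ∘ Sym2.map (Subtype.val : ({o}ᶜ : Set V) → V))).real
              (((openConn a₁ a₃ ∪ ({ω' : BondConfig ({o}ᶜ : Set V) | ∃ u : ({o}ᶜ : Set V), (u : V) ∈ B₂ ∧ ω' ∈ openConn a₁ u} ∩ {ω' : BondConfig ({o}ᶜ : Set V) | ∃ v : ({o}ᶜ : Set V), (v : V) ∈ B₂ ∧ ω' ∈ openConn v a₃})))ᶜ ∩ ({ω' : BondConfig ({o}ᶜ : Set V) | ∃ u : ({o}ᶜ : Set V), (u : V) ∈ B₂ ∧ ω' ∈ openConn u a₁} ∩ (openConn a₃ b ∪ ({ω' : BondConfig ({o}ᶜ : Set V) | ∃ u : ({o}ᶜ : Set V), (u : V) ∈ B₂ ∧ ω' ∈ openConn a₃ u} ∩ {ω' : BondConfig ({o}ᶜ : Set V) | ∃ v : ({o}ᶜ : Set V), (v : V) ∈ B₂ ∧ ω' ∈ openConn v b})))) *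
                (prodBernoulli (w ∘ Sym2.map (Subtype.val : ({o}ᶜ : Set V) → V))).real
              (((openConn a₁ a₃ ∪ ({ω' : BondConfig ({o}ᶜ : Set V) | ∃ u : ({o}ᶜ : Set V), (u : V) ∈ B₃ ∧ ω' ∈ openConn a₁ u} ∩ {ω' : BondConfig ({o}ᶜ : Set V) | ∃ v : ({o}ᶜ : Set V), (v : V) ∈ B₃ ∧ ω' ∈ openConn v a₃})))ᶜ ∩ (openConn a₁ b ∪ ({ω' : BondConfig ({o}ᶜ : Set V) | ∃ u : ({o}ᶜ : Set V), (u : V) ∈ B₃ ∧ ω' ∈ openConn a₁ u} ∩ {ω' : BondConfig ({o}ᶜ : Set V) | ∃ v : ({o}ᶜ : Set V), (v : V) ∈ B₃ ∧ ω' ∈ openConn v b})))) -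
          (prodBernoulli (w ∘ Sym2.map (Subtype.val : ({o}ᶜ : Set V) → V))).real
              (((openConn a₂ a₁ ∪ ({ω' : BondConfig ({o}ᶜ : Set V) | ∃ u : ({o}ᶜ : Set V), (u : V) ∈ B₁ ∧ ω' ∈ openConn a₂ u} ∩ {ω' : BondConfig ({o}ᶜ : Set V) | ∃ v : ({o}ᶜ : Set V), (v : V) ∈ B₁ ∧ ω' ∈ openConn v a₁})))ᶜ ∩ ((openConn a₂ a₃ ∪ ({ω' : BondConfig ({o}ᶜ : Set V) | ∃ u : ({o}ᶜ : Set V), (u : V) ∈ B₁ ∧ ω' ∈ openConn a₂ u} ∩ {ω' : BondConfig ({o}ᶜ : Set V) | ∃ v : ({o}ᶜ : Set V), (v : V) ∈ B₁ ∧ ω' ∈ openConn v a₃})))ᶜ ∩ {ω' : BondConfig ({o}ᶜ : Set V) | ∃ u : ({o}ᶜ : Set V), (u : V) ∈ B₁ ∧ ω' ∈ openConn u a₂}) *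
            ((prodBernoulli (w ∘ Sym2.map (Subtype.val : ({o}ᶜ : Set V) → V))).real
              (((openConn a₁ a₃ ∪ ({ω' : BondConfig ({o}ᶜ : Set V) | ∃ u : ({o}ᶜ : Set V), (u : V) ∈ B₂ ∧ ω' ∈ openConn a₁ u} ∩ {ω' : BondConfig ({o}ᶜ : Set V) | ∃ v : ({o}ᶜ : Set V), (v : V) ∈ B₂ ∧ ω' ∈ openConn v a₃})))ᶜ ∩ ((openConn a₁ a₂ ∪ ({ω' : BondConfig ({o}ᶜ : Set V) | ∃ u : ({o}ᶜ : Set V), (u : V) ∈ B₂ ∧ ω' ∈ openConn a₁ u} ∩ {ω' : BondConfig ({o}ᶜ : Set V) | ∃ v : ({o}ᶜ : Set V), (v : V) ∈ B₂ ∧ ω' ∈ openConn v a₂})) ∩ (openConn a₁ b ∪ ({ω' : BondConfig ({o}ᶜ : Set V) | ∃ u : ({o}ᶜ : Set V), (u : V) ∈ B₂ ∧ ω' ∈ openConn a₁ u} ∩ {ω' : BondConfig ({o}ᶜ : Set V) | ∃ v : ({o}ᶜ : Set V), (v : V) ∈ B₂ ∧ ω' ∈ openConn v b})))) *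
                (prodBernoulli (w ∘ Sym2.map (Subtype.val : ({o}ᶜ : Set V) → V))).real
              (((openConn a₁ a₃ ∪ ({ω' : BondConfig ({o}ᶜ : Set V) | ∃ u : ({o}ᶜ : Set V), (u : V) ∈ B₃ ∧ ω' ∈ openConn a₁ u} ∩ {ω' : BondConfig ({o}ᶜ : Set V) | ∃ v : ({o}ᶜ : Set V), (v : V) ∈ B₃ ∧ ω' ∈ openConn v a₃})))ᶜ ∩ (openConn a₃ b ∪ ({ω' : BondConfig ({o}ᶜ : Set V) | ∃ u : ({o}ᶜ : Set V), (u : V) ∈ B₃ ∧ ω' ∈ openConn a₃ u} ∩ {ω' : BondConfig ({o}ᶜ : Set V) | ∃ v : ({o}ᶜ : Set V), (v : V) ∈ B₃ ∧ ω' ∈ openConn v b}))) -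
              (prodBernoulli (w ∘ Sym2.map (Subtype.val : ({o}ᶜ : Set V) → V))).real
              (((openConn a₁ a₃ ∪ ({ω' : BondConfig ({o}ᶜ : Set V) | ∃ u : ({o}ᶜ : Set V), (u : V) ∈ B₂ ∧ ω' ∈ openConn a₁ u} ∩ {ω' : BondConfig ({o}ᶜ : Set V) | ∃ v : ({o}ᶜ : Set V), (v : V) ∈ B₂ ∧ ω' ∈ openConn v a₃})))ᶜ ∩ ((openConn a₁ a₂ ∪ ({ω' : BondConfig ({o}ᶜ : Set V) | ∃ u : ({o}ᶜ : Set V), (u : V) ∈ B₂ ∧ ω' ∈ openConn a₁ u} ∩ {ω' : BondConfig ({o}ᶜ : Set V) | ∃ v : ({o}ᶜ : Set V), (v : V) ∈ B₂ ∧ ω' ∈ openConn v a₂})) ∩ (openConn a₃ b ∪ ({ω' : BondConfig ({o}ᶜ : Set V) | ∃ u : ({o}ᶜ : Set V), (u : V) ∈ B₂ ∧ ω' ∈ openConn a₃ u} ∩ {ω' : BondConfig ({o}ᶜ : Set V) | ∃ v : ({o}ᶜ : Set V), (v : V) ∈ B₂ ∧ ω' ∈ openConn v b})))) *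
                (prodBernoulli (w ∘ Sym2.map (Subtype.val : ({o}ᶜ : Set V) → V))).real
              (((openConn a₁ a₃ ∪ ({ω' : BondConfig ({o}ᶜ : Set V) | ∃ u : ({o}ᶜ : Set V), (u : V) ∈ B₃ ∧ ω' ∈ openConn a₁ u} ∩ {ω' : BondConfig ({o}ᶜ : Set V) | ∃ v : ({o}ᶜ : Set V), (v : V) ∈ B₃ ∧ ω' ∈ openConn v a₃})))ᶜ ∩ (openConn a₁ b ∪ ({ω' : BondConfig ({o}ᶜ : Set V) | ∃ u : ({o}ᶜ : Set V), (u : V) ∈ B₃ ∧ ω' ∈ openConn a₁ u} ∩ {ω' : BondConfig ({o}ᶜ : Set V) | ∃ v : ({o}ᶜ : Set V), (v : V) ∈ B₃ ∧ ω' ∈ openConn v b})))))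
    (hpos : ∀ B₁ ∈ A.powerset, ∀ B₂ ∈ A.powerset, ∀ B₃ ∈ A.powerset,
      0 ≤ Ψ B₁ B₂ B₃ + Ψ B₁ B₃ B₂ + Ψ B₂ B₁ B₃ + Ψ B₂ B₃ B₁ + Ψ B₃ B₁ B₂ + Ψ B₃ B₂ B₁) :
    (prodBernoulli w).real ((openConn (a₂ : V) (a₁ : V))ᶜ ∩ (openConn (a₂ : V) (a₃ : V))ᶜ ∩ openConn (a₂ : V) o) *
        ((prodBernoulli w).real ((openConn (a₁ : V) (a₃ : V))ᶜ ∩ (openConn (a₁ : V) (a₂ : V) ∩ openConn (a₁ : V) (b : V))) *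
            (prodBernoulli w).real ((openConn (a₁ : V) (a₃ : V))ᶜ ∩ openConn (a₃ : V) (b : V)) -
          (prodBernoulli w).real ((openConn (a₁ : V) (a₃ : V))ᶜ ∩ (openConn (a₁ : V) (a₂ : V) ∩ openConn (a₃ : V) (b : V))) *
            (prodBernoulli w).real ((openConn (a₁ : V) (a₃ : V))ᶜ ∩ openConn (a₁ : V) (b : V))) ≤
      (prodBernoulli w).real ((openConn (a₂ : V) (a₁ : V))ᶜ ∩ (openConn (a₂ : V) (a₃ : V))ᶜ) *
        ((prodBernoulli w).real ((openConn (a₁ : V) (a₃ : V))ᶜ ∩ (openConn (a₁ : V) o ∩ openConn (a₁ : V) (b : V))) *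
            (prodBernoulli w).real ((openConn (a₁ : V) (a₃ : V))ᶜ ∩ openConn (a₃ : V) (b : V)) -
          (prodBernoulli w).real ((openConn (a₁ : V) (a₃ : V))ᶜ ∩ (openConn (a₁ : V) o ∩ openConn (a₃ : V) (b : V))) *
            (prodBernoulli w).real ((openConn (a₁ : V) (a₃ : V))ᶜ ∩ openConn (a₁ : V) (b : V))) := by
  refine y13_of_starMonomials w o (b : V) (a₁ : V) (a₂ : V) (a₃ : V) A ho hiso
    (fun B₁ B₂ B₃ =>
      (prodBernoulli w).real (((openConn (a₂ : V) (a₁ : V))ᶜ ∩ (openConn (a₂ : V) (a₃ : V))ᶜ) ∩ starEvent o ↑B₁) *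
            ((prodBernoulli w).real (((openConn (a₁ : V) (a₃ : V))ᶜ ∩ (openConn (a₁ : V) o ∩ openConn (a₁ : V) (b : V))) ∩ starEvent o ↑B₂) *
                (prodBernoulli w).real (((openConn (a₁ : V) (a₃ : V))ᶜ ∩ openConn (a₃ : V) (b : V)) ∩ starEvent o ↑B₃) -
              (prodBernoulli w).real (((openConn (a₁ : V) (a₃ : V))ᶜ ∩ (openConn (a₁ : V) o ∩ openConn (a₃ : V) (b : V))) ∩ starEvent o ↑B₂) *
                (prodBernoulli w).real (((openConn (a₁ : V) (a₃ : V))ᶜ ∩ openConn (a₁ : V) (b : V)) ∩ starEvent o ↑B₃)) -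
          (prodBernoulli w).real (((openConn (a₂ : V) (a₁ : V))ᶜ ∩ (openConn (a₂ : V) (a₃ : V))ᶜ ∩ openConn (a₂ : V) o) ∩ starEvent o ↑B₁) *
            ((prodBernoulli w).real (((openConn (a₁ : V) (a₃ : V))ᶜ ∩ (openConn (a₁ : V) (a₂ : V) ∩ openConn (a₁ : V) (b : V))) ∩ starEvent o ↑B₂) *
                (prodBernoulli w).real (((openConn (a₁ : V) (a₃ : V))ᶜ ∩ openConn (a₃ : V) (b : V)) ∩ starEvent o ↑B₃) -
              (prodBernoulli w).real (((openConn (a₁ : V) (a₃ : V))ᶜ ∩ (openConn (a₁ : V) (a₂ : V) ∩ openConn (a₃ : V) (b : V))) ∩ starEvent o ↑B₂) *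
                (prodBernoulli w).real (((openConn (a₁ : V) (a₃ : V))ᶜ ∩ openConn (a₁ : V) (b : V)) ∩ starEvent o ↑B₃)))
    (fun _ _ _ => rfl) ?_
  intro B₁ hB₁ B₂ hB₂ B₃ hB₃
  have hB₁' : ∀ u ∈ B₁, u ≠ o := fun u hu => ne_of_mem_of_not_mem (Finset.mem_powerset.1 hB₁ hu) ho
  have hB₂' : ∀ u ∈ B₂, u ≠ o := fun u hu => ne_of_mem_of_not_mem (Finset.mem_powerset.1 hB₂ hu) ho
  have hB₃' : ∀ u ∈ B₃, u ≠ o := fun u hu => ne_of_mem_of_not_mem (Finset.mem_powerset.1 hB₃ hu) ho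
  have s1 : 0 ≤ (prodBernoulli w).real (starEvent o (↑B₁ : Set V)) := measureReal_nonneg
  have s2 : 0 ≤ (prodBernoulli w).real (starEvent o (↑B₂ : Set V)) := measureReal_nonneg
  have s3 : 0 ≤ (prodBernoulli w).real (starEvent o (↑B₃ : Set V)) := measureReal_nonneg
  have f123 := sm_kernel_factor w o a₁ a₂ a₃ b Ψ hΨ B₁ B₂ B₃ hB₁' hB₂' hB₃'
  have f132 := sm_kernel_factor w o a₁ a₂ a₃ b Ψ hΨ B₁ B₃ B₂ hB₁' hB₃' hB₂'
  have f213 := sm_kernel_factor w o a₁ a₂ a₃ b Ψ hΨ B₂ B₁ B₃ hB₂' hB₁' hB₃'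
  have f231 := sm_kernel_factor w o a₁ a₂ a₃ b Ψ hΨ B₂ B₃ B₁ hB₂' hB₃' hB₁'
  have f312 := sm_kernel_factor w o a₁ a₂ a₃ b Ψ hΨ B₃ B₁ B₂ hB₃' hB₁' hB₂'
  have f321 := sm_kernel_factor w o a₁ a₂ a₃ b Ψ hΨ B₃ B₂ B₁ hB₃' hB₂' hB₁'

  rw [f123, f132, f213, f231, f312, f321]
  have hK := hpos B₁ hB₁ B₂ hB₂ B₃ hB₃
  have h := mul_nonneg (mul_nonneg (mul_nonneg s1 s2) s3) hK
  nlinarith [h]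

end GluedMonomials

end

end Summit.CriticalPhenomena.PercolationContinuityZ3.Theorems
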